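import Summits.CriticalPhenomena.PercolationContinuityZ3.Theorems.PercNearOneGluingNoHeavyLowerTailSahiSlotCell34Colour

/-!
# The cell `(3,4)` in the kernel, VI: COVERING — every antichain of `[4]^3` is enumerated, and one of its six axis images is canonical

Support file of the one-cut programme (crux `NoHeavyLowerTail`, stmt-CriticalPhenomena-4575; cell `prim-masterthm`, seat P3, gen 19;
`run/shared/lean/prim/prim-masterthm/prim-masterthm-p3/HIERARCHY.md` §27).  Companion of `…SahiSlotCell34Check/…/Colour`.

* `enc_mem_acList` — the depth-first enumeration `acGo` of the checker lists (the mask of) EVERY antichain of the slot cube: along the cells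
  `0, …, 63` the partial mask of `N` is carried, and the cell `c ∈ N` may always be added because `N` is an antichain (`cur &&& cmpMask c = 0`);
* `axPerm`, `axCell_code` (by evaluation), `enc_axImage` — the checker's six coordinate permutations act on masks as `q ↦ q ∘ ρ` acts on points;
* **`exists_canonical`** — for every antichain `N` some axis image `N.image (· ∘ ρ)` has its mask in `canonList` (take the image of least mask;
  `isCanon` asks exactly for minimality among the six images, and images of images are images);
* `colourFamily_axImage`, **`patternForm_colourFamily_axImage`** — the coloured-antichain family of the image is the image of the family
  (`SahiSlot.patternForm_comp_axisPerm`).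
HONEST LABEL: glue; the final theorem is `…SahiSlotPatternThreeFour`. [this work]
-/

namespace Summit.CriticalPhenomena.PercolationContinuityZ3.Theorems

namespace SahiSlot34

open Finset Equiv
open Literature.Combinatorics.Sahi2008 (setInd)

/-! ### Every antichain is enumerated -/

/-- Bitwise-disjoint numbers have `&&& = 0`. [this work] -/
theorem land_eq_zero_of_disjoint {x y : ℕ} (h : ∀ i, x.testBit i = true → y.testBit i = true → False) : x &&& y = 0 := by
  apply Nat.eq_of_testBit_eq
  intro i
  rw [Nat.testBit_land, Nat.zero_testBit]
  cases hx : x.testBit i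
  · rfl
  · cases hy : y.testBit i
    · rfl
    · exact (h i hx hy).elim

/-- The comparability table. [this work] -/
theorem cmpTab_getD {c : ℕ} (hc : c < 64) : cmpTab.getD c 0 = cmpMask c := by
  rw [show cmpTab = Array.ofFn (n := 64) (fun p => cmpMask p.val) from rfl, getD_ofFn _ _ hc]

/-- Bits of `cmpMask`. [this work] -/
theorem testBit_cmpMask (p c : ℕ) : (cmpMask p).testBit c = (decide (c < 64) && (cle c p || cle p c)) := by
  unfold cmpMask; rw [testBit_ofBits]

/-- The low `c` bits of the mask of `N` (the partial antichain carried by the enumeration). [this work] -/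
def encLow (N : Finset (SahiSlot.Q 3 4)) (c : ℕ) : ℕ := ofBits (fun x => decide (decode x ∈ N)) c

/-- Bits of `encLow`. [this work] -/
theorem testBit_encLow (N : Finset (SahiSlot.Q 3 4)) (c x : ℕ) : (encLow N c).testBit x = (decide (x < c) && decide (decode x ∈ N)) := by
  unfold encLow; rw [testBit_ofBits]

/-- One more cell, inside `N`. [this work] -/
theorem encLow_succ_of_mem {N : Finset (SahiSlot.Q 3 4)} {c : ℕ} (h : decode c ∈ N) : encLow N (c + 1) = encLow N c ||| 2 ^ c := by
  have hlt : encLow N c < 2 ^ c := ofBits_lt _ _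
  have h2 : 2 ^ c * 1 + encLow N c = 2 ^ c * 1 ||| encLow N c := Nat.two_pow_add_eq_or_of_lt hlt 1
  rw [mul_one] at h2
  rw [Nat.lor_comm, ← h2]
  show encLow N c + 2 ^ c * (decide (decode c ∈ N)).toNat = _
  rw [show (decide (decode c ∈ N)).toNat = 1 by simp [h]]
  ring

/-- One more cell, outside `N`. [this work] -/
theorem encLow_succ_of_not_mem {N : Finset (SahiSlot.Q 3 4)} {c : ℕ} (h : decode c ∉ N) : encLow N (c + 1) = encLow N c := by
  show ofBits _ (c + 1) = _
  rw [ofBits, show (decide (decode c ∈ N)).toNat = 0 by simp [h]]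
  show encLow N c + 2 ^ c * 0 = encLow N c
  ring

/-- `decode` is injective on codes `< 64`. [this work] -/
theorem decode_injOn {x y : ℕ} (hx : x < 64) (hy : y < 64) (h : decode x = decode y) : x = y := by
  rw [← code_decode hx, ← code_decode hy, h]

/-- **COMPLETENESS OF THE ENUMERATION** (inductive form). [this work] -/
theorem acGo_complete (N : Finset (SahiSlot.Q 3 4)) (hN : IsAntichain (· ≤ ·) (N : Set (SahiSlot.Q 3 4))) :
    ∀ k c : ℕ, c + k = 64 → enc N ∈ acGo cmpTab k c (encLow N c) := by
  intro k
  induction k with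
  | zero =>
    intro c hc
    have hc64 : c = 64 := by omega
    subst hc64
    show enc N ∈ [encLow N 64]
    exact List.mem_singleton.2 rfl
  | succ k ih =>
    intro c hc
    have hc64 : c < 64 := by omega
    show enc N ∈ acGo cmpTab k (c + 1) (encLow N c) ++
      (if (encLow N c &&& cmpTab.getD c 0 == 0) = true then acGo cmpTab k (c + 1) (encLow N c ||| 2 ^ c) else [])
    rw [List.mem_append]
    by_cases hcN : decode c ∈ N
    · right
      have hzero : encLow N c &&& cmpTab.getD c 0 = 0 := by
        rw [cmpTab_getD hc64]
        apply land_eq_zero_of_disjoint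
        intro i hi hci
        rw [testBit_encLow] at hi
        rw [testBit_cmpMask] at hci
        simp only [Bool.and_eq_true, decide_eq_true_eq, Bool.or_eq_true] at hi hci
        obtain ⟨hic, hiN⟩ := hi
        obtain ⟨hi64, hcmp⟩ := hci
        have hne : decode i ≠ decode c := fun h => by have := decode_injOn hi64 hc64 h; omega
        rcases hcmp with h1 | h1
        · rw [← code_decode hi64, ← code_decode hc64, cle_code_iff] at h1
          exact hN hiN hcN hne h1
        · rw [← code_decode hi64, ← code_decode hc64, cle_code_iff] at h1
          exact hN hcN hiN (Ne.symm hne) h1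
      rw [hzero, if_pos (by decide), ← encLow_succ_of_mem hcN]
      exact ih (c + 1) (by omega)
    · left
      rw [← encLow_succ_of_not_mem hcN]
      exact ih (c + 1) (by omega)

/-- **Every antichain of `[4]^3` is in the checker's list.** [this work] -/
theorem enc_mem_acList {N : Finset (SahiSlot.Q 3 4)} (hN : IsAntichain (· ≤ ·) (N : Set (SahiSlot.Q 3 4))) : enc N ∈ acList := by
  have h := acGo_complete N hN 64 0 rfl
  have h0 : encLow N 0 = 0 := rfl
  rw [h0] at h
  exact h

/-! ### The six coordinate permutations -/

/-- The checker's `s`-th coordinate permutation as an element of `S_3` (`axL = [[0,1,2],[0,2,1],[1,0,2],[1,2,0],[2,0,1],[2,1,0]]`). [this work] -/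
def axPerm : Fin 6 → Perm (Fin 3)
  | ⟨0, _⟩ => 1
  | ⟨1, _⟩ => swap 1 2
  | ⟨2, _⟩ => swap 0 1
  | ⟨3, _⟩ => swap 0 1 * swap 1 2
  | ⟨4, _⟩ => swap 1 2 * swap 0 1
  | ⟨_ + 5, _⟩ => swap 0 2

/-- The cell table acts on codes as `q ↦ q ∘ ρ` acts on points (by evaluation on the `6 × 64` cases). [this work] -/
theorem axCell_code : ∀ (s : Fin 6) (q : SahiSlot.Q 3 4), axCell s.val (code q) = code (q ∘ ⇑(axPerm s)) := by native_decide

/-- The six permutations are all of `S_3` (by evaluation). [this work] -/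
theorem axPerm_surj : ∀ ρ : Perm (Fin 3), ∃ s : Fin 6, axPerm s = ρ := by native_decide

/-- The flattened cell table. [this work] -/
theorem axTab_getD {s c : ℕ} (hs : s < 6) (hc : c < 64) : axTab.getD (64 * s + c) 0 = axCell s c := by
  rw [show axTab = Array.ofFn (n := 6 * 64) (fun e => axCell (e.val / 64) (e.val % 64)) from rfl, getD_ofFn _ _ (by omega)]
  have h1 : (64 * s + c) / 64 = s := by omega
  have h2 : (64 * s + c) % 64 = c := by omega
  simp only [h1, h2]

/-- Bits of an or-fold. [this work] -/
theorem testBit_foldl_lor (f : ℕ → ℕ) : ∀ (cells : List ℕ) (acc x : ℕ),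
    (cells.foldl (fun acc c => acc ||| (1 <<< f c)) acc).testBit x = (acc.testBit x || decide (∃ c ∈ cells, f c = x)) := by
  intro cells
  induction cells with
  | nil => intro acc x; simp
  | cons c cs ih =>
    intro acc x
    rw [List.foldl_cons, ih, Nat.testBit_lor, Nat.shiftLeft_eq, one_mul, Nat.testBit_two_pow, Bool.or_assoc]
    congr 1
    rw [Bool.eq_iff_iff]
    simp only [Bool.or_eq_true, decide_eq_true_eq, List.mem_cons]
    constructor
    · rintro (h | ⟨c', hc', h⟩)
      · exact ⟨c, Or.inl rfl, h⟩
      · exact ⟨c', Or.inr hc', h⟩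
    · rintro ⟨c', hc' | hc', h⟩
      · subst hc'; exact Or.inl h
      · exact Or.inr ⟨c', hc', h⟩

/-- Membership in `cellsOf`. [this work] -/
theorem mem_cellsOf {m c : ℕ} : c ∈ cellsOf m ↔ c < 64 ∧ m.testBit c = true := by
  unfold cellsOf; simp [List.mem_filter, List.mem_range]

/-- The axis image of a finset of points. [this work] -/
def axImage (ρ : Perm (Fin 3)) (N : Finset (SahiSlot.Q 3 4)) : Finset (SahiSlot.Q 3 4) := N.image fun q => q ∘ ⇑ρ

/-- The checker's image mask is the mask of the axis image. [this work] -/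
theorem axImg_eq_enc (s : Fin 6) (N : Finset (SahiSlot.Q 3 4)) : axImg axTab s.val (cellsOf (enc N)) = enc (axImage (axPerm s) N) := by
  apply Nat.eq_of_testBit_eq
  intro x
  unfold axImg
  rw [testBit_foldl_lor, Nat.zero_testBit, Bool.false_or, testBit_enc]
  unfold axImage
  by_cases hx : x < 64
  · simp only [hx, decide_true, Bool.true_and, mem_image]
    apply Bool.decide_congr
    constructor
    · rintro ⟨c, hc, hcx⟩
      obtain ⟨hc64, hbit⟩ := mem_cellsOf.1 hc
      rw [testBit_enc] at hbit
      simp only [hc64, decide_true, Bool.true_and, decide_eq_true_eq] at hbit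
      rw [axTab_getD s.isLt hc64, ← code_decode hc64, axCell_code] at hcx
      exact ⟨decode c, hbit, by rw [← decode_code (decode c ∘ ⇑(axPerm s)), hcx]⟩
    · rintro ⟨q, hq, hqx⟩
      refine ⟨code q, mem_cellsOf.2 ⟨code_lt q, by rw [testBit_enc]; simp [code_lt q, decode_code, hq]⟩, ?_⟩
      rw [axTab_getD s.isLt (code_lt q), axCell_code, hqx, code_decode hx]
  · simp only [hx, decide_false, Bool.false_and]
    rw [decide_eq_false_iff_not]
    rintro ⟨c, hc, hcx⟩
    obtain ⟨hc64, -⟩ := mem_cellsOf.1 hc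
    rw [axTab_getD s.isLt hc64, ← code_decode hc64, axCell_code] at hcx
    exact hx (hcx ▸ code_lt _)

/-- `isCanon` unfolded. [this work] -/
theorem isCanon_iff (m : ℕ) : isCanon axTab m = true ↔ ∀ s < 6, m ≤ axImg axTab s (cellsOf m) := by
  unfold isCanon; simp [List.all_eq_true, List.mem_range]

/-- Images of images are images. [this work] -/
theorem axImage_axImage (σ ρ : Perm (Fin 3)) (N : Finset (SahiSlot.Q 3 4)) : axImage σ (axImage ρ N) = axImage (ρ * σ) N := by
  unfold axImage
  rw [image_image]
  congr 1

/-- The axis image of an antichain is an antichain. [this work] -/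
theorem isAntichain_axImage (ρ : Perm (Fin 3)) {N : Finset (SahiSlot.Q 3 4)} (hN : IsAntichain (· ≤ ·) (N : Set (SahiSlot.Q 3 4))) :
    IsAntichain (· ≤ ·) (axImage ρ N : Set (SahiSlot.Q 3 4)) := by
  intro a ha b hb hne hle
  unfold axImage at ha hb
  rw [coe_image] at ha hb
  obtain ⟨q, hq, rfl⟩ := ha
  obtain ⟨p, hp, rfl⟩ := hb
  have hne' : q ≠ p := fun h => hne (by rw [h])
  refine hN hq hp hne' fun a => ?_
  have := hle (ρ.symm a)
  simpa using this

/-- `canonList` unfolded. [this work] -/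
theorem mem_canonList {m : ℕ} : m ∈ canonList ↔ m ∈ acList ∧ isCanon axTab m = true := by
  rw [show canonList = acList.filter (isCanon axTab) from rfl, List.mem_filter]

/-- **EVERY ANTICHAIN HAS A CANONICAL AXIS IMAGE.** [this work] -/
theorem exists_canonical {N : Finset (SahiSlot.Q 3 4)} (hN : IsAntichain (· ≤ ·) (N : Set (SahiSlot.Q 3 4))) :
    ∃ ρ : Perm (Fin 3), enc (axImage ρ N) ∈ canonList := by
  obtain ⟨ρ₀, -, hmin⟩ := exists_min_image (univ : Finset (Perm (Fin 3))) (fun ρ => enc (axImage ρ N)) univ_nonempty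
  refine ⟨ρ₀, mem_canonList.2 ⟨enc_mem_acList (isAntichain_axImage ρ₀ hN), (isCanon_iff _).2 fun s hs => ?_⟩⟩
  rw [axImg_eq_enc ⟨s, hs⟩, axImage_axImage]
  exact hmin _ (mem_univ _)

/-! ### Transport of the coloured-antichain family under the axis group -/

/-- The coloured-antichain family of an axis image is the image of the family. [this work] -/
theorem mem_colourFamily_axImage (ρ : Perm (Fin 3)) (N : Finset (SahiSlot.Q 3 4)) (c : SahiSlot.Q 3 4 → Fin 4) (i : Fin 4)
    (q : SahiSlot.Q 3 4) :
    q ∈ colourFamily (axImage ρ N) (fun q' => c (q' ∘ ⇑ρ.symm)) i ↔ (q ∘ ⇑ρ.symm) ∈ colourFamily N c i := by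
  rw [mem_colourFamily, mem_colourFamily]
  unfold axImage
  constructor
  · intro h p hp hcp hle
    have hp' : (p ∘ ⇑ρ) ∈ N.image (fun q => q ∘ ⇑ρ) := mem_image_of_mem _ hp
    refine h (p ∘ ⇑ρ) hp' ?_ ?_
    · show c ((p ∘ ⇑ρ) ∘ ⇑ρ.symm) = i
      have : (p ∘ ⇑ρ) ∘ ⇑ρ.symm = p := by funext a; simp
      rw [this]; exact hcp
    · intro a
      have := hle (ρ a)
      simpa using this
  · intro h p' hp' hcp' hle
    rw [mem_image] at hp'
    obtain ⟨p, hp, rfl⟩ := hp'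
    have hcp : c p = i := by
      have : (p ∘ ⇑ρ) ∘ ⇑ρ.symm = p := by funext a; simp
      rw [this] at hcp'; exact hcp'
    refine h p hp hcp fun a => ?_
    have := hle (ρ.symm a)
    simpa using this

/-- **The pattern functional of the coloured-antichain family is invariant under the axis group** (`patternForm_comp_axisPerm`). [this work] -/
theorem patternForm_colourFamily_axImage (ρ : Perm (Fin 3)) (N : Finset (SahiSlot.Q 3 4)) (c : SahiSlot.Q 3 4 → Fin 4) :
    SahiSlot.patternForm 3 4 (fun i => setInd (colourFamily (axImage ρ N) (fun q' => c (q' ∘ ⇑ρ.symm)) i)) =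
      SahiSlot.patternForm 3 4 (fun i => setInd (colourFamily N c i)) := by
  have h : (fun i => setInd (colourFamily (axImage ρ N) (fun q' => c (q' ∘ ⇑ρ.symm)) i)) =
      fun i => setInd (colourFamily N c i) ∘ fun q : SahiSlot.Q 3 4 => q ∘ ⇑ρ.symm := by
    funext i q
    simp only [Function.comp_apply, setInd, mem_colourFamily_axImage]
  rw [h]
  exact SahiSlot.patternForm_comp_axisPerm (fun i => setInd (colourFamily N c i)) ρ.symm

end SahiSlot34

end Summit.CriticalPhenomena.PercolationContinuityZ3.Theorems
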